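import Summits.ResolutionOfSingularities.ResolutionOfSingularities.Theorems.PurelyInseparableDim4ScopeBlindLaurent
import Literature.AlgebraicGeometry.Resolution.CoordinateBlowupProperTransform
import Mathlib.RingTheory.Polynomial.UniqueFactorization
import HarnessLib

/-!
# THE GCD LEAF: one implicit leaf for EVERY uniform-out locus `{x_T = 0, h = 0}` — witness ideal `(x_T, h)`, the point
# constrained by `h(b) = 0` only; the prime is manufactured by unique factorisation (cell `res-dim4-pi`, ∀K column)

[OURS · counted 0 · frame bookkeeping] Nothing here is a statement about resolution of singularities.
Seat res-dim4-p-8 g4, FIRST BRICK (desk WORD #118 (e)) = res-dim4-eng-w2 g2's «GCD LEAF» proposal (bus 2026-08-29 01:32:10Z; its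
certificate table `en9gcdleaf.tsv` a9620a43615b73f0: 111/111 no-σ UNIFORM-OUT loci of the 23 root-blocked roots of the (2,2) ∀K
column — Laurent 49 · 𝔽₄ pairs 35 · poly-param 6 · the 21 genus-1 cylinders/cones that NO parametrised leaf reaches).
The p-8 g3 leaf kit (`…ScopeBlindSubst` / `…NormLeaf` / `…Laurent` / `…ParamCert` / `…SubstDomain`) certified blindness along a
witness variety by KILLING its ideal with a substitution (polynomial, 𝔽₄-linear, Laurent, parametrised, or into a prime quotient whose
absolute primality was the uncertified residue).  Here NO substitution and NO primality certificate: the witness ideal is `(x_T, h)`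
with `h ∈ K[x_{T^c}]`, and at a point `b` (`b_T = 0`, `h(b) = 0`) the prime is MANUFACTURED — `K[x]` is a UFD, so `h(x + b)`, which
vanishes at the origin, has a PRIME factor `r` vanishing at the origin, and `ψ = (K[x] → K[x]/(r)) ∘ (x_T ↦ 0)` maps to a domain
with `J_q⁺(G(x + b)) ⊆ ker ψ ⊆ 𝔪₀`.  The one thing to rule out is `r ~ x_i` (`i ∉ T`), i.e. `x_i ∣ h(x + b)`, i.e. `h` vanishing
identically on the hyperplane `{x_i = b_i}` — hypothesis (ii), discharged over EVERY field by a univariate BÉZOUT identity among the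
`x_i`-slices of `h` in the certificate file `…ScopeBlindGcdLeafCert` (`gcdLeafB`, res-dim4-typ-3g9's row interface).

* §1 plumbing: `aeval_freeze_translate` (killing `x_i` after `x ↦ x + b` = translating after freezing `x_i := b_i`),
  `aeval_freeze_eq_zero_of_X_dvd_translate`, **`exists_prime_dvd_of_eval_zero`** (UFD: a non-zero polynomial vanishing at `0` has a
  prime factor vanishing at `0`; Mathlib's `MvPolynomial.uniqueFactorizationMonoid`, the tree's `prime_X_of_isDomain`);
* §2 **`not_inCoordinateScope_translate_of_gcdLeaf`** (any field `K`, any `q`): `h` free of `x_T`; (i) `(D^{(α)}G)(x_T ↦ 0) ∈ (h)` for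
  `0 < |α| < q`; (ii) `h(x_i ↦ β) ≠ 0` for every `i ∉ T`, `β ∈ K`; (iii) one `(D^{(α₀)}G)(x_T ↦ 0) ≠ 0` ⟹ at EVERY `b` with `b_T = 0`,
  `h(b) = 0` the translated state `G(x + b)` is OUT of coordinate scope (into res-dim4-p-3's `IsolationCert.not_inCoordinateScope_of_prime`);
  **`not_inCoordinateScope_step_of_gcdLeaf`** — the child form (`q = p`: cleaning does not change `J_p⁺`).

Caveat (eng-w2's): this certifies LEAVES (single children OUT of scope); the chart COVER remains res-dim4-typ-3g9's row checker; (ii) is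
sufficient, not necessary (a witness `h` with a genuine hyperplane factor must be split first — none occurs in the 111 rows).
OURS; counted 0.  bears_on: LADDER-RESOLUTION:D157-DOOR2 (res-dim4-pi · ∀K column · GCD leaf).  Supports stmt-ResolutionOfSingularities-16155 (helper).
-/

set_option linter.dupNamespace false -- mandated namespace of this single-conjunct summit

noncomputable section

open MvPolynomial Finset
open scoped BigOperators

namespace Summit.ResolutionOfSingularities.ResolutionOfSingularities.Theorems.PIDim4

namespace ScopeBlind

open Literature.AlgebraicGeometry.Resolution
open Literature.AlgebraicGeometry.Resolution.CentreBlowup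
open Literature.AlgebraicGeometry.Resolution.Hauser2010
open StepKit ScopeCover ScopeDynamics IsolationCert CurveBlind

/-! ## §1 Plumbing: freezing a coordinate, and a prime factor through the origin -/

section OverK

variable {K : Type} [Field K]

/-- **killing `x_i` after translating by `b` = translating after freezing `x_i := b_i`.** [folklore] -/
theorem aeval_freeze_translate (i : Fin 4) (b : Fin 4 → K) (h : MvPolynomial (Fin 4) K) :
    MvPolynomial.aeval (R := K) (fun j : Fin 4 => if j = i then (0 : MvPolynomial (Fin 4) K) else X j)
        (PointBlowup.translate b h) =
      PointBlowup.translate b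
        (MvPolynomial.aeval (R := K) (fun j : Fin 4 => if j = i then C (b i) else (X j : MvPolynomial (Fin 4) K)) h) := by
  rw [translate_def, translate_def, ← AlgHom.comp_apply, ← AlgHom.comp_apply]
  have hc : (MvPolynomial.aeval (R := K) (fun j : Fin 4 => if j = i then (0 : MvPolynomial (Fin 4) K) else X j)).comp
        (MvPolynomial.aeval (R := K) fun j => (X j + C (b j) : MvPolynomial (Fin 4) K)) =
      (MvPolynomial.aeval (R := K) fun j => (X j + C (b j) : MvPolynomial (Fin 4) K)).comp
        (MvPolynomial.aeval (R := K) (fun j : Fin 4 => if j = i then C (b i) else (X j : MvPolynomial (Fin 4) K))) := by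
    refine MvPolynomial.algHom_ext fun j => ?_
    by_cases hj : j = i
    · subst hj
      simp
    · simp [hj]
  exact DFunLike.congr_fun hc h

/-- **if `x_i` divides `h(x + b)` then `h` vanishes identically on the hyperplane `{x_i = b_i}`.** [folklore] -/
theorem aeval_freeze_eq_zero_of_X_dvd_translate (i : Fin 4) (b : Fin 4 → K) (h : MvPolynomial (Fin 4) K)
    (hdvd : (X i : MvPolynomial (Fin 4) K) ∣ PointBlowup.translate b h) :
    MvPolynomial.aeval (R := K) (fun j : Fin 4 => if j = i then C (b i) else (X j : MvPolynomial (Fin 4) K)) h = 0 := by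
  obtain ⟨s, hs⟩ := hdvd
  have hk := congrArg
    (MvPolynomial.aeval (R := K) (fun j : Fin 4 => if j = i then (0 : MvPolynomial (Fin 4) K) else X j)) hs
  rw [aeval_freeze_translate, map_mul, MvPolynomial.aeval_X, if_pos rfl, zero_mul] at hk
  exact eq_zero_of_translate_eq_zero b hk

/-- **a non-zero polynomial vanishing at the origin has a PRIME factor vanishing at the origin** (`K[x₁..x₄]` is a UFD: take the
prime factorisation and read it at `0`). [cite: AtiyahMacdonald1969, Ch. 1 (prime ideals; Ex. 1.8)] [folklore] -/
theorem exists_prime_dvd_of_eval_zero {g : MvPolynomial (Fin 4) K} (hg : g ≠ 0)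
    (h0 : MvPolynomial.eval (0 : Fin 4 → K) g = 0) :
    ∃ r : MvPolynomial (Fin 4) K, Prime r ∧ r ∣ g ∧ MvPolynomial.eval (0 : Fin 4 → K) r = 0 := by
  classical
  obtain ⟨u, hu⟩ := UniqueFactorizationMonoid.factors_prod hg
  have hprod : MvPolynomial.eval (0 : Fin 4 → K) (UniqueFactorizationMonoid.factors g).prod = 0 := by
    have h1 := congrArg (MvPolynomial.eval (0 : Fin 4 → K)) hu
    rw [map_mul, h0] at h1
    have hunit : IsUnit (MvPolynomial.eval (0 : Fin 4 → K) (u : MvPolynomial (Fin 4) K)) := u.isUnit.map _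
    exact hunit.mul_left_eq_zero.mp h1
  rw [map_multiset_prod, Multiset.prod_eq_zero_iff, Multiset.mem_map] at hprod
  obtain ⟨r, hr, hr0⟩ := hprod
  exact ⟨r, UniqueFactorizationMonoid.prime_of_factor r hr, UniqueFactorizationMonoid.dvd_of_mem_factors hr, hr0⟩

/-! ## §2 The GCD leaf over a field -/

/-- **THE GCD LEAF.**  Let `h` be free of the coordinates `x_T` (`h(x_T ↦ 0) = h`), let every Hasse derivative `D^{(α)}G`,
`0 < |α| < q`, lie in `(x_T, h)` — certificate (i): `(D^{(α)}G)(x_T ↦ 0) = c_α · h` — let `h` vanish identically on NO coordinate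
hyperplane `{x_i = β}`, `i ∉ T`, `β ∈ K` (certificate (ii), from a Bézout identity: `aeval_freeze_ne_zero_of_bezoutB`), and let ONE
`(D^{(α₀)}G)(x_T ↦ 0) ≠ 0` (certificate (iii)).  Then at EVERY point `b` with `b_T = 0` and `h(b) = 0` the translated state `G(x + b)`
is OUT of coordinate scope.  Proof: a prime factor `r` of `h(x + b)` through the origin (UFD), the domain `K[x]/(r)`, the map
`ψ = quot ∘ (x_T ↦ 0)`; `J_q⁺(G(x + b)) ≤ ker ψ ≤ 𝔪₀`; `x_i ∈ ker ψ` for `i ∉ T` would force `r ~ x_i ∣ h(x + b)`, i.e. `h ≡ 0` on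
`{x_i = b_i}`; and `J_q⁺ ⊄ (x_T)` by (iii) — res-dim4-p-3's `not_inCoordinateScope_of_prime`. OURS.
[cite: AtiyahMacdonald1969, Ch. 1 (prime ideals; minimal primes, Ex. 1.8)] -/
theorem not_inCoordinateScope_translate_of_gcdLeaf {q : ℕ} (G h : MvPolynomial (Fin 4) K) (T : Finset (Fin 4))
    (hhT : MvPolynomial.aeval (R := K) (fun i : Fin 4 => if i ∈ T then (0 : MvPolynomial (Fin 4) K) else X i) h = h)
    (hJ : ∀ α : Fin 4 →₀ ℕ, 0 < α.degree → α.degree < q → ∃ c : MvPolynomial (Fin 4) K,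
      MvPolynomial.aeval (R := K) (fun i : Fin 4 => if i ∈ T then (0 : MvPolynomial (Fin 4) K) else X i)
        (hasseDeriv α G) = c * h)
    (hX : ∀ i : Fin 4, i ∉ T → ∀ β : K,
      MvPolynomial.aeval (R := K) (fun j : Fin 4 => if j = i then C β else (X j : MvPolynomial (Fin 4) K)) h ≠ 0)
    (α₀ : Fin 4 →₀ ℕ) (hα0 : 0 < α₀.degree) (hαq : α₀.degree < q)
    (hW : MvPolynomial.aeval (R := K) (fun i : Fin 4 => if i ∈ T then (0 : MvPolynomial (Fin 4) K) else X i)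
      (hasseDeriv α₀ G) ≠ 0)
    (b : Fin 4 → K) (hbT : ∀ i ∈ T, b i = 0) (hb : MvPolynomial.eval b h = 0) :
    ¬ InCoordinateScope q (PointBlowup.translate b G) := by
  classical
  -- `h ≠ 0`, hence `h(x + b) ≠ 0`, and `h(x + b)` vanishes at the origin
  have hh0 : h ≠ 0 := by
    rintro rfl
    obtain ⟨c, hc⟩ := hJ α₀ hα0 hαq
    rw [mul_zero] at hc
    exact hW hc
  have hb0 : PointBlowup.translate b h ≠ 0 := fun h0 => hh0 (eq_zero_of_translate_eq_zero b h0)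
  have hbev : MvPolynomial.eval (0 : Fin 4 → K) (PointBlowup.translate b h) = 0 := by
    rw [eval_translate_add, zero_add]
    exact hb
  -- a prime factor through the origin and the domain `K[x]/(r)`
  obtain ⟨r, hr, hrh, hr0⟩ := exists_prime_dvd_of_eval_zero hb0 hbev
  haveI hI : (Ideal.span ({r} : Set (MvPolynomial (Fin 4) K))).IsPrime := (Ideal.span_singleton_prime hr.ne_zero).mpr hr
  haveI : IsDomain (MvPolynomial (Fin 4) K ⧸ Ideal.span ({r} : Set (MvPolynomial (Fin 4) K))) :=
    (Ideal.Quotient.isDomain_iff_prime _).mpr hI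
  let ψ : MvPolynomial (Fin 4) K →+* MvPolynomial (Fin 4) K ⧸ Ideal.span ({r} : Set (MvPolynomial (Fin 4) K)) :=
    (Ideal.Quotient.mk (Ideal.span ({r} : Set (MvPolynomial (Fin 4) K)))).comp
      (MvPolynomial.aeval (R := K) (fun i : Fin 4 => if i ∈ T then (0 : MvPolynomial (Fin 4) K) else X i)).toRingHom
  have hψ : ∀ g, ψ g = 0 ↔
      r ∣ MvPolynomial.aeval (R := K) (fun i : Fin 4 => if i ∈ T then (0 : MvPolynomial (Fin 4) K) else X i) g := fun g => by
    rw [show ψ g = Ideal.Quotient.mk (Ideal.span ({r} : Set (MvPolynomial (Fin 4) K)))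
        (MvPolynomial.aeval (R := K) (fun i : Fin 4 => if i ∈ T then (0 : MvPolynomial (Fin 4) K) else X i) g) from rfl,
      Ideal.Quotient.eq_zero_iff_mem, Ideal.mem_span_singleton]
  refine IsolationCert.not_inCoordinateScope_of_prime (P := RingHom.ker ψ) (RingHom.ker_isPrime ψ) ?_ ?_ T ?_ ?_
  · -- `J_q⁺(G(x + b)) ≤ ker ψ` by certificate (i)
    unfold singLocusIdeal
    rw [Ideal.span_le]
    rintro _ ⟨α, h0', hq', rfl⟩
    obtain ⟨c, hc⟩ := hJ α h0' hq'
    rw [SetLike.mem_coe, RingHom.mem_ker, hψ, ScopeDynamics.hasseDeriv_translate, aeval_killT_translate T b hbT, hc,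
      translate_def, map_mul]
    exact Dvd.dvd.mul_left hrh _
  · -- `ker ψ ≤ 𝔪₀` since `r(0) = 0`
    intro g hg
    rw [RingHom.mem_ker, hψ] at hg
    obtain ⟨s, hs⟩ := hg
    unfold originIdeal
    rw [RingHom.mem_ker, ← eval_zero_aeval_killT T g, hs, map_mul, hr0, zero_mul]
  · -- no `x_i`, `i ∉ T`, in `ker ψ`: else `r ~ x_i ∣ h(x + b)`, certificate (ii)
    intro i hi
    by_contra hiT
    rw [RingHom.mem_ker, hψ, MvPolynomial.aeval_X, if_neg hiT] at hi
    have hass : Associated r (X i) := hr.irreducible.associated_of_dvd (prime_X_of_isDomain K i).irreducible hi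
    exact hX i hiT (b i) (aeval_freeze_eq_zero_of_X_dvd_translate i b h (hass.dvd_iff_dvd_left.mp hrh))
  · -- `J_q⁺ ⊄ (x_T)`: certificate (iii), kill `x_T` and undo the translation
    intro hle
    have hD : hasseDeriv α₀ (PointBlowup.translate b G) ∈ singLocusIdeal q (PointBlowup.translate b G) :=
      Ideal.subset_span ⟨α₀, hα0, hαq, rfl⟩
    have hk := aeval_killT_eq_zero_of_mem_span T (hle hD)
    rw [ScopeDynamics.hasseDeriv_translate, aeval_killT_translate T b hbT] at hk
    exact hW (eq_zero_of_translate_eq_zero b hk)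

/-- **The frame's child at such a point is OUT of coordinate scope** (`q = p` the characteristic: cleaning does not change `J_p⁺`).
OURS. [folklore] -/
theorem not_inCoordinateScope_step_of_gcdLeaf (p : ℕ) [Fact p.Prime] [CharP K p] [DecidableEq K] (S : Finset (Fin 4))
    (j : Fin 4) (s : State K) (h : MvPolynomial (Fin 4) K) (T : Finset (Fin 4))
    (hhT : MvPolynomial.aeval (R := K) (fun i : Fin 4 => if i ∈ T then (0 : MvPolynomial (Fin 4) K) else X i) h = h)
    (hJ : ∀ α : Fin 4 →₀ ℕ, 0 < α.degree → α.degree < p → ∃ c : MvPolynomial (Fin 4) K,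
      MvPolynomial.aeval (R := K) (fun i : Fin 4 => if i ∈ T then (0 : MvPolynomial (Fin 4) K) else X i)
        (hasseDeriv α (chartTransform p S j s.F)) = c * h)
    (hX : ∀ i : Fin 4, i ∉ T → ∀ β : K,
      MvPolynomial.aeval (R := K) (fun j : Fin 4 => if j = i then C β else (X j : MvPolynomial (Fin 4) K)) h ≠ 0)
    (α₀ : Fin 4 →₀ ℕ) (hα0 : 0 < α₀.degree) (hαq : α₀.degree < p)
    (hW : MvPolynomial.aeval (R := K) (fun i : Fin 4 => if i ∈ T then (0 : MvPolynomial (Fin 4) K) else X i)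
      (hasseDeriv α₀ (chartTransform p S j s.F)) ≠ 0)
    (b : Fin 4 → K) (hbT : ∀ i ∈ T, b i = 0) (hb : MvPolynomial.eval b h = 0) :
    ¬ InCoordinateScope p (CentreBlowup.step p S j b s).F := by
  have hF : (CentreBlowup.step p S j b s).F = deletePthPowers p (PointBlowup.translate b (chartTransform p S j s.F)) := rfl
  unfold InCoordinateScope
  rw [hF, IsolatedBand.singLocusIdeal_deletePthPowers]
  exact not_inCoordinateScope_translate_of_gcdLeaf _ h T hhT hJ hX α₀ hα0 hαq hW b hbT hb

end OverK

end ScopeBlind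

end Summit.ResolutionOfSingularities.ResolutionOfSingularities.Theorems.PIDim4

end
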